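import Summits.CriticalPhenomena.PercolationContinuityZ3.Theorems.PercNearOneGluingNoHeavyQuantFarSunLayerTwoMid12
import Summits.CriticalPhenomena.PercolationContinuityZ3.Theorems.PercNearOneGluingNoHeavyQuantFarSunLayerTwoMid13
import Summits.CriticalPhenomena.PercolationContinuityZ3.Theorems.PercNearOneGluingNoHeavyQuantFarSunLayerTwoMid14
import Summits.CriticalPhenomena.PercolationContinuityZ3.Theorems.PercNearOneGluingNoHeavyQuantFarSunLayerTwoMid1516
import Summits.CriticalPhenomena.PercolationContinuityZ3.Theorems.PercNearOneGluingNoHeavyQuantFarSunLayerTwoMid1819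
import Mathlib.Tactic.Linarith
import HarnessLib

/-!
# FAR beyond trees: LAYER 2 OF FAR ON EVERY HAIRY CYCLE WITH `K ≥ 12` HAIRS — `∀ K ≥ 12, SunFAR K 2`

builds on p205010 (kernel theorem, internal audit signed; external expert review pending)

Support file (`--supports stmt-CriticalPhenomena-4575`), seat `prim-cert-1` (gen 39); memo `prim-cert-1/FROM-prim-cert-1-g39-VERTEX-GAME.md`.
`HairyCycle.sunFAR_two_of_cert_from` is the assembly of `…LayerTwoAllK` with the hypothesis weakened from "`witGavg ≥ 1` on `R`" to "SOME hair-only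
certificate on `R`": off `R` the weakest-hair bet (`hairCert_of_weakestBet`, THM B) serves.  Feeding the certificates of …LayerTwoMid12/…Mid/…Mid13/…Mid14/…Mid1516/
…Mid1819 (`hairCert_two_of_R_K`, `K = 12 … 19`; `hairCert_two_of_R_ge_twenty`, `K ≥ 20`) gives **`HairyCycle.sunFAR_two_of_ge_twelve : ∀ K ≥ 12, SunFAR K 2`**
(improving `∀ K ≥ 85` of …LayerTwoLargeK), and with the kernel's `K ≤ 10` (`sunFAR_of_le_ten`) **`HairyCycle.sunFAR_two_of_ne_eleven`**; the remaining
`K = 11` is the kernel certificate `sunFAR_eleven_two` (…CertElevenTwoD).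
Elementary [this work]; no sorries; standard axioms (+ `Lean.ofReduceBool` through the certificates).
-/

noncomputable section

namespace Summit.CriticalPhenomena.PercolationContinuityZ3.Theorems.HairyCycle

open Finset

/-- **Layer two from `K₁` on, from hair-only certificates on `R`.**  If for every `K ≥ K₁` (`K₁ ≥ 2`) and every `h ∈ [0,1]` (everywhere) with least
weight `h m` (`m < K`), `4 < Σ` and `2(F − η) < η(Σ − 4)` a hair-only certificate exists, then `SunFAR K 2` for every `K ≥ K₁`
(off `R`: `hairCert_of_weakestBet`). [this work] -/
theorem sunFAR_two_of_cert_from (K₁ : ℕ) (hK₁ : 2 ≤ K₁)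
    (hcert : ∀ K : ℕ, K₁ ≤ K → ∀ h : ℕ → ℝ, (∀ k, 0 ≤ h k ∧ h k ≤ 1) → ∀ m : ℕ, m < K → (∀ k, k < K → h m ≤ h k) →
      (4 : ℝ) < ∑ k ∈ range K, h k → 2 * (hairV K h 2 (range K) - h m) < h m * (∑ k ∈ range K, h k - 4) →
      ∃ lam : ℕ → ℝ, ∃ μ : ℝ, (∀ k, 0 ≤ lam k) ∧ ∑ k ∈ range K, lam k = 1 ∧ 0 ≤ μ ∧
        ∀ p ∈ arcIx K, ∑ k ∈ cov K p.1 p.2, lam k * h k + μ * (∑ k ∈ cov K p.1 p.2, h k - 2 * (2 : ℕ)) ≤ hairV K h 2 (cov K p.1 p.2)) :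
    ∀ K : ℕ, K₁ ≤ K → SunFAR K 2 := by
  intro K hK
  have hK2 : 2 ≤ K := le_trans hK₁ hK
  refine sunFAR_of_hairCert hK2 fun g h hg hh hEN => ?_
  have hS4 : (4 : ℝ) < ∑ k ∈ range K, h k := by
    have h1 : ∑ k ∈ range K, sunMarg K g h k ≤ ∑ k ∈ range K, h k :=
      Finset.sum_le_sum fun k hk => sunMarg_le_h hK2 hg (Finset.mem_range.1 hk) (hh k (Finset.mem_range.1 hk)).1
    have h2 : (2 * (2 : ℕ) : ℝ) = 4 := by norm_num
    linarith [h2 ▸ hEN]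
  obtain ⟨m, hmK, hmin⟩ := Finset.exists_min_image (range K) h ⟨0, Finset.mem_range.2 (by omega)⟩
  have hm : m < K := Finset.mem_range.1 hmK
  have hmin' : ∀ k, k < K → h m ≤ h k := fun k hk => hmin k (Finset.mem_range.2 hk)
  -- truncate `h` outside `range K`
  set h' : ℕ → ℝ := fun k => if k < K then h k else 0 with hh'def
  have he : ∀ k, k < K → h' k = h k := fun k hk => by rw [hh'def]; simp only [hk, if_true]
  have hh' : ∀ k, 0 ≤ h' k ∧ h' k ≤ 1 := by
    intro k
    by_cases hk : k < K
    · rw [he k hk]; exact hh k hk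
    · rw [hh'def]; simp only [hk, if_false]; norm_num
  have hsum : ∑ k ∈ range K, h' k = ∑ k ∈ range K, h k := Finset.sum_congr rfl fun k hk => he k (Finset.mem_range.1 hk)
  have hF : hairV K h' 2 (range K) = hairV K h 2 (range K) := hairV_congr he 2 (range K)
  have hmin'' : ∀ k, k < K → h' m ≤ h' k := fun k hk => by rw [he m hm, he k hk]; exact hmin' k hk
  -- on `R`: the supplied certificate; off `R`: THM B
  have hc' : ∃ lam : ℕ → ℝ, ∃ μ : ℝ, (∀ k, 0 ≤ lam k) ∧ ∑ k ∈ range K, lam k = 1 ∧ 0 ≤ μ ∧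
      ∀ p ∈ arcIx K, ∑ k ∈ cov K p.1 p.2, lam k * h' k + μ * (∑ k ∈ cov K p.1 p.2, h' k - 2 * (2 : ℕ)) ≤ hairV K h' 2 (cov K p.1 p.2) := by
    by_cases hR : 2 * (hairV K h' 2 (range K) - h' m) < h' m * (∑ k ∈ range K, h' k - 4)
    · exact hcert K hK h' hh' m hm hmin'' (by rw [hsum]; exact hS4) hR
    · push Not at hR
      exact hairCert_of_weakestBet (K := K) hh' (by rw [hsum]; exact hS4) hm hmin'' hR
  obtain ⟨lam, μ, hlam, hlam1, hμ, hrows⟩ := hc'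
  refine ⟨lam, μ, hlam, hlam1, hμ, fun p hp => ?_⟩
  have hr := hrows p hp
  rw [hairV_congr he 2, sum_cov_congr he (fun k x => lam k * x), sum_cov_congr he (fun _ x => x)] at hr
  exact hr

/-- **`SunFAR K 2` FOR EVERY `K ≥ 13`.** [this work] -/
theorem sunFAR_two_of_ge_twelve : ∀ K : ℕ, 12 ≤ K → SunFAR K 2 := by
  refine sunFAR_two_of_cert_from 12 (by norm_num) fun K hK h hh m hm hmin hS4 hR => ?_
  by_cases h20 : 20 ≤ K
  · exact hairCert_two_of_R_ge_twenty h20 hh hmin hS4 hR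
  · interval_cases K
    · exact hairCert_two_of_R_12 hh hm hmin hS4 hR
    · exact hairCert_two_of_R_13 hh hm hmin hS4 hR
    · exact hairCert_two_of_R_14 hh hmin hS4 hR
    · exact hairCert_two_of_R_15 hh hmin hS4 hR
    · exact hairCert_two_of_R_16 hh hmin hS4 hR
    · exact hairCert_two_of_R_17 hh hmin hS4 hR
    · exact hairCert_two_of_R_18 hh hmin hS4 hR
    · exact hairCert_two_of_R_19 hh hmin hS4 hR

/-- **`SunFAR K 2` FOR EVERY `K ≥ 2` EXCEPT (here) `K = 11`**: `K ≤ 10` by the per-`K` kernel certificates (`sunFAR_of_le_ten`), `K ≥ 12` by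
`sunFAR_two_of_ge_twelve`.  (`K = 11` is `HairyCycle.sunFAR_eleven_two`, …CertElevenTwoD, landing separately; the three are combined in …QuantFarSunLayerTwo.) [this work] -/
theorem sunFAR_two_of_ne_eleven {K : ℕ} (hK : 2 ≤ K) (h11 : K ≠ 11) : SunFAR K 2 := by
  by_cases h10 : K ≤ 10
  · exact sunFAR_of_le_ten hK h10 2
  · exact sunFAR_two_of_ge_twelve K (by omega)

end Summit.CriticalPhenomena.PercolationContinuityZ3.Theorems.HairyCycle

end
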